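import Summits.Langlands.Langlands.Theorems.SoloInformedPurityDoor
import Literature.AlgebraicGeometry.Motives.HodgeTensorHodgeNumberProofs
import HarnessLib

/-!
# Pure dominance rigidity: the purity door WITHOUT genericity (solo seat `solo-Langlands-informed`)

New mathematics relative to the audited statement `Summit.Langlands` (not a reproduction).

`SoloInformedPurityDoor` typed the observation that Galois-side weight–monodromy purity at a
finite place `v` reduces `LocalGlobalCompatibleAt 𝓡 ι π ρ v` to semisimple compatibility, GIVEN
that the automorphic side `rec_v(π_v)` is a *generic* Weil–Deligne representation.  That
genericity is true (local components of cuspidal `π` are generic and `rec` of a generic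
representation is generic) but it is a statement about the VALUES of `rec_v`, which the pinned
local Langlands datum `𝓡.llc v` does not expose.  This file removes the hypothesis: it is replaced
by RANK DOMINANCE of the monodromy operators, `rk N_{Gal}^i ≤ rk N_{Aut}^i` for all `i` — exactly
the shape of I. Varma's theorem "`WD(r_ι(π)|_{G_v})^{F-ss} ≺ rec(π_v)`" (Forum Math. Sigma 2024,
Thm. 2), which is proved for the congruence-built Galois representations WITHOUT knowing
local–global compatibility.

## The rigidity theorem (kernel-checked, no named facts)

* `lefschetz_of_finrank_range_pow_le` (graded linear algebra): let `E = ⊕_j W_j` be a finite-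
  dimensional graded space, `N, N'` two endomorphisms of degree `-2`, `N` *Lefschetz*
  (`N^i : W_i ⥲ W_{-i}` for all `i ≥ 0`).  If `rk N^i ≤ rk N'^i` for every `i`, then `N'` is
  Lefschetz too.  Proof: `rk T = Σ_j dim T(W_j)` for `T = N^i, N'^i` (independence of the
  `W_{j-2i}`); termwise `dim N'^i(W_j) ≤ min (dim W_j, dim W_{j-2i}) = dim N^i(W_j)` (the last
  equality is the Lefschetz property of `N`); so dominance forces termwise equality, and at
  `j = i` this is bijectivity of `N'^i : W_i → W_{-i}`.
* `isPure_of_finrank_range_pow_le`: a complex Weil–Deligne representation `S` with the same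
  Weil-group action as a PURE one `R` and with `rk R.N^i ≤ rk S.N^i` (all `i`) is pure (of the
  same weight); hence (`isEquivalent_of_isPure_of_finrank_range_pow_le`, with Taylor–Yoshida's
  Lemma 1.4 (4) = `IsPure.isEquivalent` of the tree) `R ≅ S` when `R` is Frobenius-semisimple.
  In words: **a pure monodromy operator is maximal for rank dominance among all monodromy
  operators for its Weil-group action, and anything dominating it is conjugate to it.**

## The door, re-typed against the summit statement

`localGlobalCompatibleAt_of_isPure_of_finrank_range_pow_le`: semisimple compatibility in
representative form (`W` a Frobenius-semisimple representative of `rec_v(π_v)` with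
`W.ρ = (ι WD_v(ρ))^{F-ss}.ρ` — Varma's Thm. 1 shape), rank dominance `rk N_{Gal}^i ≤ rk N_W^i`
(Varma's Thm. 2 shape, weakened from her inertia-isotypic `≺_I` to total ranks) and PURITY of
`(ι WD_v(ρ))^{F-ss}` imply `LocalGlobalCompatibleAt 𝓡 ι π ρ v`.  Neither Ramanujan/temperedness of
`π_v` nor genericity of `rec_v(π_v)` is assumed: purity of the automorphic side is an OUTPUT.
So, modulo the two printed theorems of Varma (stated there for the Harris–Lan–Taylor–Thorne /
Scholze representations over CM fields), the residue of local–global compatibility at `v ∤ ℓ` is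
the single statement "`WD_v(ρ)^{F-ss}` is pure" — the weight–monodromy conjecture for these
non-geometrically-constructed Galois representations (door D4-gal of the seat's SHARPEST.md).

References: R. Taylor, T. Yoshida, *Compatibility of local and global Langlands correspondences*,
J. Amer. Math. Soc. 20 (2007), Lemma 1.4 [cite: TaylorYoshida2007, Lemma 1.4 (4)];
I. Varma, *Local–global compatibility for regular algebraic cuspidal automorphic representations
when ℓ ≠ p*, Forum Math. Sigma 12 (2024), Thms. 1–2, Def. 8.2–8.3 [cite: VarmaFMS2024, Thm. 2];
L. A'Campo, B. Hevesi, J. Thorne, D. Whitmore, arXiv:2607.11763, Cor. 6.0.6 (the generic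
analogue: `≺` plus genericity of the smaller side forces equality) [cite: AHTW2026, Cor. 6.0.6].
-/

noncomputable section

namespace Summit.Langlands.Langlands.Theorems

open scoped MatrixGroups Matrix Classical Polynomial NumberField
open NumberField IsDedekindDomain Field Polynomial Filter Module
open Literature.NumberTheory.Automorphic Literature.NumberTheory.GaloisRepresentations
open Literature.NumberTheory.GaloisRepresentations.IsNonarchimedeanLocalField
open Literature.AlgebraicGeometry.Motives (finrank_biSup_eq_sum_of_iSupIndep)

section GradedLinearAlgebra

variable {K : Type*} [Field K] {E : Type*} [AddCommGroup E] [Module K E]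

/-- An endomorphism of degree `-2` of a `ℤ`-graded space has `m`-th power of degree `-2m`.
[folklore] -/
theorem pow_apply_mem_of_forall_apply_mem_sub_two {W : ℤ → Submodule K E} {T : E →ₗ[K] E}
    (hT : ∀ j, ∀ x ∈ W j, T x ∈ W (j - 2)) (m : ℕ) (j : ℤ) {x : E} (hx : x ∈ W j) :
    (T ^ m) x ∈ W (j - 2 * m) := by
  induction m with
  | zero => simpa using hx
  | succ m ih =>
    rw [pow_succ', Module.End.mul_apply]
    have h := hT _ _ ih
    convert h using 2
    push_cast; ring

/-- `dim T(p) = dim p` when `T` has no kernel on `p`. [folklore] -/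
theorem finrank_map_eq_of_forall_eq_zero [FiniteDimensional K E] (p : Submodule K E)
    (T : E →ₗ[K] E) (h : ∀ x ∈ p, T x = 0 → x = 0) : finrank K ↥(p.map T) = finrank K p := by
  have hker : LinearMap.ker (T ∘ₗ p.subtype) = ⊥ := by
    rw [LinearMap.ker_eq_bot']
    rintro ⟨x, hx⟩ h0
    exact Subtype.ext (h x hx (by simpa using h0))
  have hsum := LinearMap.finrank_range_add_finrank_ker (T ∘ₗ p.subtype)
  rw [hker, finrank_bot, add_zero, LinearMap.range_comp, Submodule.range_subtype] at hsum
  exact hsum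

/-- Conversely, `dim T(p) = dim p` forces `T` to have no kernel on `p` (rank–nullity). [folklore] -/
theorem forall_eq_zero_of_finrank_map_eq [FiniteDimensional K E] (p : Submodule K E)
    (T : E →ₗ[K] E) (h : finrank K ↥(p.map T) = finrank K p) :
    ∀ x ∈ p, T x = 0 → x = 0 := by
  have hsum := LinearMap.finrank_range_add_finrank_ker (T ∘ₗ p.subtype)
  rw [LinearMap.range_comp, Submodule.range_subtype, h] at hsum
  have hker : LinearMap.ker (T ∘ₗ p.subtype) = ⊥ := by
    rw [← Submodule.finrank_eq_zero]; omega
  intro x hx h0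
  have hmem : (⟨x, hx⟩ : p) ∈ LinearMap.ker (T ∘ₗ p.subtype) := by simpa using h0
  rw [hker, Submodule.mem_bot] at hmem
  exact congrArg Subtype.val hmem

/-- **Graded Lefschetz rigidity under rank dominance.**  `E = ⊕_j W_j` finite-dimensional
(`W` independent and spanning), `N, N'` endomorphisms of degree `-2`, `N` Lefschetz:
`N^i(W_i) = W_{-i}` and `N^i` injective on `W_i` for every `i : ℕ`.  If `rk N^i ≤ rk N'^i` for
every `i`, then `N'` is Lefschetz as well.  (For each `i`: `rk T = Σ_j dim T(W_j)`, and termwise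
`dim N'^i(W_j) ≤ min(dim W_j, dim W_{j-2i}) = dim N^i(W_j)`; dominance gives termwise equality,
read off at `j = i`.)  This is the linear algebra behind "a pure monodromy operator is
rank-maximal and rigid". [new] -/
theorem lefschetz_of_finrank_range_pow_le [FiniteDimensional K E] {W : ℤ → Submodule K E}
    (hind : iSupIndep W) (htop : (⨆ j, W j) = ⊤) {N N' : E →ₗ[K] E}
    (hN : ∀ j, ∀ x ∈ W j, N x ∈ W (j - 2)) (hN' : ∀ j, ∀ x ∈ W j, N' x ∈ W (j - 2))
    (hsurj : ∀ i : ℕ, (W i).map (N ^ i) = W (-(i : ℤ)))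
    (hinj : ∀ i : ℕ, ∀ x ∈ W i, (N ^ i) x = 0 → x = 0)
    (hdom : ∀ i : ℕ, finrank K ↥(LinearMap.range (N ^ i)) ≤
      finrank K ↥(LinearMap.range (N' ^ i))) (i : ℕ) :
    (W i).map (N' ^ i) = W (-(i : ℤ)) ∧ ∀ x ∈ W i, (N' ^ i) x = 0 → x = 0 := by
  classical
  -- finitely many nonzero graded pieces
  set s : Finset ℤ := (Submodule.finite_ne_bot_of_iSupIndep hind).toFinset with hs_def
  have hs : ∀ j, j ∉ s → W j = ⊥ := by
    intro j hj
    by_contra hne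
    exact hj ((Set.Finite.mem_toFinset _).mpr hne)
  have hdeg := fun (T : E →ₗ[K] E) (hT : ∀ j, ∀ x ∈ W j, T x ∈ W (j - 2)) =>
    pow_apply_mem_of_forall_apply_mem_sub_two hT
  -- the rank of a degree `-2i` map is the sum of the dimensions of the images of the pieces
  have hrank : ∀ T : E →ₗ[K] E, (∀ j, ∀ x ∈ W j, T x ∈ W (j - 2 * i)) →
      finrank K ↥(LinearMap.range T) = ∑ j ∈ s, finrank K ↥((W j).map T) := by
    intro T hT
    have h1 : iSupIndep (W ∘ fun j : ℤ => j - 2 * (i : ℤ)) := hind.comp sub_left_injective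
    have hU : iSupIndep fun j => (W j).map T :=
      h1.mono fun j => Submodule.map_le_iff_le_comap.mpr fun x hx => hT j x hx
    have hr : LinearMap.range T = ⨆ j ∈ s, (W j).map T := by
      rw [LinearMap.range_eq_map, ← htop, Submodule.map_iSup]
      refine le_antisymm (iSup_le fun j => ?_)
        (iSup₂_le fun j _ => le_iSup (fun j => (W j).map T) j)
      by_cases hj : j ∈ s
      · exact le_iSup₂_of_le j hj le_rfl
      · rw [hs j hj, Submodule.map_bot]; exact bot_le
    rw [hr]
    exact finrank_biSup_eq_sum_of_iSupIndep hU s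
  have eN := hrank (N ^ i) (hdeg N hN i)
  have eN' := hrank (N' ^ i) (hdeg N' hN' i)
  -- termwise comparison `dim N'^i(W_j) ≤ dim N^i(W_j)`
  have hle : ∀ j ∈ s, finrank K ↥((W j).map (N' ^ i)) ≤ finrank K ↥((W j).map (N ^ i)) := by
    intro j _
    by_cases hji : (i : ℤ) ≤ j
    · -- `N^i` is injective on `W_j` for `j ≥ i`
      have hinjj : ∀ x ∈ W j, (N ^ i) x = 0 → x = 0 := by
        intro x hx h0
        obtain ⟨d, hd⟩ : ∃ d : ℕ, j = i + d := ⟨(j - i).toNat, by omega⟩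
        have hx' : x ∈ W ((d + i : ℕ) : ℤ) := by
          convert hx using 2; push_cast; omega
        exact hinj (d + i) x hx' (by rw [pow_add, Module.End.mul_apply, h0, map_zero])
      calc finrank K ↥((W j).map (N' ^ i)) ≤ finrank K (W j) := Submodule.finrank_map_le _ _
        _ = finrank K ↥((W j).map (N ^ i)) := (finrank_map_eq_of_forall_eq_zero _ _ hinjj).symm
    · -- `W_{j-2i} ⊆ N^i(W_j)` for `j < i`
      push Not at hji
      obtain ⟨e, he⟩ : ∃ e : ℕ, (e : ℤ) = i - j := ⟨(i - j).toNat, by omega⟩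
      have hsub : W (j - 2 * i) ≤ (W j).map (N ^ i) := by
        have h1 : W (j - 2 * i) = (W ((i + e : ℕ) : ℤ)).map (N ^ (i + e)) := by
          rw [hsurj (i + e)]; congr 1; push_cast; omega
        rw [h1, pow_add, Module.End.mul_eq_comp, Submodule.map_comp]
        refine Submodule.map_mono ?_
        rintro _ ⟨x, hx, rfl⟩
        have h2 := hdeg N hN e _ hx
        convert h2 using 2; push_cast; omega
      calc finrank K ↥((W j).map (N' ^ i)) ≤ finrank K (W (j - 2 * i)) := by
            refine Submodule.finrank_mono ?_
            rintro _ ⟨x, hx, rfl⟩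
            exact hdeg N' hN' i _ hx
        _ ≤ finrank K ↥((W j).map (N ^ i)) := Submodule.finrank_mono hsub
  -- dominance forces termwise equality
  have hsum_eq : ∑ j ∈ s, finrank K ↥((W j).map (N' ^ i)) =
      ∑ j ∈ s, finrank K ↥((W j).map (N ^ i)) :=
    le_antisymm (Finset.sum_le_sum hle) (by rw [← eN, ← eN']; exact hdom i)
  have hterm := (Finset.sum_eq_sum_iff_of_le hle).mp hsum_eq
  -- read off at `j = i`
  have hWi : finrank K ↥((W i).map (N' ^ i)) = finrank K (W i) := by
    by_cases hi : (i : ℤ) ∈ s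
    · rw [hterm i hi]; exact finrank_map_eq_of_forall_eq_zero _ _ (hinj i)
    · rw [hs i hi, Submodule.map_bot]
  refine ⟨Submodule.eq_of_le_of_finrank_eq ?_ ?_, forall_eq_zero_of_finrank_map_eq _ _ hWi⟩
  · rintro _ ⟨x, hx, rfl⟩
    have h2 := hdeg N' hN' i _ hx
    convert h2 using 2; ring
  · rw [hWi, ← finrank_map_eq_of_forall_eq_zero _ _ (hinj i), hsurj i]

end GradedLinearAlgebra

section WeilDeligne

variable {L : Type} [Field L] [ValuativeRel L] [TopologicalSpace L] [IsNonarchimedeanLocalField L]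
  {V : Type} [AddCommGroup V] [Module ℂ V]

/-- The monodromy operator lowers weights by `2`: `N(V_j) ⊆ V_{j-2}` (`ρ(φ) N = q⁻¹ N ρ(φ)` for a
geometric Frobenius lift `φ`). [cite: TaylorYoshida2007, §1, p. 471] -/
theorem apply_N_mem_weightSpace_sub_two (r : WeilDeligneRep L ℂ V) {φ : WeilGroup L}
    (hφ : WeilGroup.deg φ = -1) (k : ℝ) (j : ℤ) {x : V} (hx : x ∈ r.weightSpace φ k j) :
    r.N x ∈ r.weightSpace φ k (j - 2) := by
  have hq1 : (1 : ℝ) < residueFieldCard L := by exact_mod_cast one_lt_residueFieldCard L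
  have hq0 : (0 : ℝ) < residueFieldCard L := zero_lt_one.trans hq1
  have hnormq : ‖(residueFieldCard L : ℂ)‖ = (residueFieldCard L : ℝ) := Complex.norm_natCast _
  have hN : r.ρ φ * r.N = (residueFieldCard L : ℂ)⁻¹ • (r.N * r.ρ φ) := by
    simp only [Module.End.mul_eq_comp]
    rw [r.conj_N φ, hφ, zpow_neg, zpow_one]
  have hcN : ‖(residueFieldCard L : ℂ)⁻¹‖ ^ 2 = (residueFieldCard L : ℝ) ^ ((-2 : ℤ) : ℝ) := by
    rw [_root_.norm_inv, hnormq, inv_pow, ← Real.rpow_natCast, ← Real.rpow_neg hq0.le]; norm_num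
  have h := r.map_weightSpace_le_of_comp_eq_smul_comp φ k hN hcN j ⟨x, hx, rfl⟩
  have e : j + (-2 : ℤ) = j - 2 := by ring
  rw [e] at h; exact h

/-- **The weight spaces are independent** (they are sums of generalised eigenspaces of `ρ(φ)`
over disjoint sets of eigenvalues, the weight being determined by `|α|`).
[cite: TaylorYoshida2007, §1, p. 471] -/
theorem weightSpace_iSupIndep (r : WeilDeligneRep L ℂ V) (φ : WeilGroup L) (k : ℝ) :
    iSupIndep (r.weightSpace φ k) := by
  classical
  have hq1 : (1 : ℝ) < residueFieldCard L := by exact_mod_cast one_lt_residueFieldCard L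
  have hinjw : ∀ {α : ℂ} {j l : ℤ}, ‖α‖ ^ 2 = (residueFieldCard L : ℝ) ^ (k + (j : ℝ)) →
      ‖α‖ ^ 2 = (residueFieldCard L : ℝ) ^ (k + (l : ℝ)) → j = l := by
    intro α j l hj hl
    have e : (residueFieldCard L : ℝ) ^ (k + (j : ℝ)) =
        (residueFieldCard L : ℝ) ^ (k + (l : ℝ)) := by rw [← hj, ← hl]
    have e' : k + (j : ℝ) = k + (l : ℝ) := le_antisymm
      ((Real.rpow_le_rpow_left_iff hq1).mp e.le) ((Real.rpow_le_rpow_left_iff hq1).mp e.ge)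
    exact_mod_cast (add_left_cancel e')
  have hG := Module.End.independent_maxGenEigenspace (r.ρ φ)
  rw [iSupIndep_def]
  intro j
  have h2 : (⨆ (l : ℤ) (_ : l ≠ j), r.weightSpace φ k l) ≤
      ⨆ α ∈ ({α : ℂ | ‖α‖ ^ 2 = (residueFieldCard L : ℝ) ^ (k + (j : ℝ))}ᶜ),
        Module.End.maxGenEigenspace (r.ρ φ) α := by
    refine iSup₂_le fun l hl => ?_
    unfold WeilDeligneRep.weightSpace
    refine iSup₂_le fun α hα => ?_
    have hαA : α ∈ ({α : ℂ | ‖α‖ ^ 2 = (residueFieldCard L : ℝ) ^ (k + (j : ℝ))}ᶜ) :=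
      fun hαj => hl (hinjw hα hαj)
    exact le_iSup₂_of_le α hαA le_rfl
  exact (hG.disjoint_biSup_biSup disjoint_compl_right).mono_right h2

/-- **Pure dominance rigidity, purity form.**  Let `R, S` be complex Weil–Deligne representations
on the same finite-dimensional space with the same Weil-group action, `R` pure of weight `k`
(w.r.t. a geometric Frobenius lift `φ`).  If `rk R.N^i ≤ rk S.N^i` for every `i`, then `S` is pure
of weight `k`.  (The weight spaces of `R` and `S` coincide; apply
`lefschetz_of_finrank_range_pow_le`.)  In particular a pure `N` is rank-maximal among the
monodromy operators for its Weil-group action. [new] (cf. [cite: AHTW2026, Cor. 6.0.6] for the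
generic analogue and [cite: VarmaFMS2024, Def. 8.2–8.3] for the dominance order) -/
theorem isPure_of_finrank_range_pow_le [FiniteDimensional ℂ V] {R S : WeilDeligneRep L ℂ V}
    {φ : WeilGroup L} (hφ : WeilGroup.deg φ = -1) {k : ℝ} (hR : R.IsPure φ k) (hρ : S.ρ = R.ρ)
    (hdom : ∀ i : ℕ, finrank ℂ ↥(LinearMap.range (R.N ^ i)) ≤
      finrank ℂ ↥(LinearMap.range (S.N ^ i))) :
    S.IsPure φ k := by
  have hW : S.weightSpace φ k = R.weightSpace φ k := by
    funext j; unfold WeilDeligneRep.weightSpace; rw [hρ]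
  obtain ⟨htop, hL⟩ := hR
  have hN : ∀ j, ∀ x ∈ R.weightSpace φ k j, R.N x ∈ R.weightSpace φ k (j - 2) :=
    fun j x hx => apply_N_mem_weightSpace_sub_two R hφ k j hx
  have hN' : ∀ j, ∀ x ∈ R.weightSpace φ k j, S.N x ∈ R.weightSpace φ k (j - 2) := by
    intro j x hx
    have h := apply_N_mem_weightSpace_sub_two S hφ k j (show x ∈ S.weightSpace φ k j by
      rw [hW]; exact hx)
    rw [hW] at h; exact h
  refine ⟨by rw [hW]; exact htop, fun i => ?_⟩
  rw [hW]
  exact lefschetz_of_finrank_range_pow_le (weightSpace_iSupIndep R φ k) htop hN hN'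
    (fun i => (hL i).1) (fun i => (hL i).2) hdom i

/-- **Pure dominance rigidity.**  A Frobenius-semisimple pure complex Weil–Deligne representation
`R` is isomorphic to every Weil–Deligne representation `S` with the same Weil-group action whose
monodromy dominates that of `R` in rank (`rk R.N^i ≤ rk S.N^i` for all `i`).  (By
`isPure_of_finrank_range_pow_le` the dominating `S` is pure; then Taylor–Yoshida, Lemma 1.4 (4).)
No genericity or purity of `S` is assumed. [new] (uses [cite: TaylorYoshida2007, Lemma 1.4 (4)]) -/
theorem isEquivalent_of_isPure_of_finrank_range_pow_le [FiniteDimensional ℂ V]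
    {R S : WeilDeligneRep L ℂ V} {φ : WeilGroup L} (hφ : WeilGroup.deg φ = -1) {k : ℝ}
    (hR : R.IsPure φ k) (hss : R.IsFrobSemisimple) (hρ : S.ρ = R.ρ)
    (hdom : ∀ i : ℕ, finrank ℂ ↥(LinearMap.range (R.N ^ i)) ≤
      finrank ℂ ↥(LinearMap.range (S.N ^ i))) :
    R.IsEquivalent S :=
  hR.isEquivalent hφ (isPure_of_finrank_range_pow_le hφ hR hρ hdom) hss hρ

variable {n : ℕ}

/-- **Purity plus rank dominance pin the Frobenius-semisimple class.**  If the
Frobenius-semisimplification `r'` of `r` is pure and `W` is ANY Frobenius-semisimple Weil–Deligne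
representation with the same Weil-group action whose monodromy dominates that of `r'` in rank,
then `r^{F-ss}` has the class of `W`. [new] (uses [cite: TaylorYoshida2007, Lemma 1.4 (4)]) -/
theorem hasFrobSemisimpleClass_of_isPure_of_finrank_range_pow_le
    {r r' : WeilDeligneRep L ℂ (Fin n → ℂ)} (h : r'.IsFrobSemisimplificationOf r)
    {φ : WeilGroup L} (hφ : WeilGroup.deg φ = -1) {k : ℝ} (hpure : r'.IsPure φ k)
    (W : {W : WeilDeligneRep L ℂ (Fin n → ℂ) // W.IsFrobSemisimple}) (hρ : W.1.ρ = r'.ρ)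
    (hdom : ∀ i : ℕ, finrank ℂ ↥(LinearMap.range (r'.N ^ i)) ≤
      finrank ℂ ↥(LinearMap.range (W.1.N ^ i))) :
    r.HasFrobSemisimpleClass (Quotient.mk (frobSemisimpleWDSetoid L n) W) :=
  ⟨r', h, Quotient.sound
    (isEquivalent_of_isPure_of_finrank_range_pow_le hφ hpure h.isFrobSemisimple hρ hdom)⟩

end WeilDeligne

variable {n : ℕ} {K : Type} [Field K] [NumberField K] {hcpt : isCompact_glFiniteIntegralLevel n K}
  {ℓ : ℕ} [Fact ℓ.Prime]

/-- **Door D4 without genericity, typed against the summit statement: Galois-side purity at `v`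
+ semisimple compatibility + rank dominance ⇒ local–global compatibility at `v`.**  Let `π_v` be
the local component of `π` at `v`, `r = WD_v(ρ)`, `rℂ = ι(r)`, `rss` a Frobenius-
semisimplification of `rℂ`, and `W` a Frobenius-semisimple representative of the class
`rec_v(π_v)` with the same Weil-group action as `rss` (semisimple compatibility, the shape of
Varma's Thm. 1) whose monodromy dominates that of `rss` in rank (the shape of Varma's Thm. 2,
`WD^{F-ss} ≺ rec`).  If `rss` is pure of some real weight with respect to some geometric Frobenius
lift, then `LocalGlobalCompatibleAt 𝓡 ι π ρ v`.  Compared with `localGlobalCompatibleAt_of_isPure`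
the hypothesis "`rec_v(π_v)` is generic" is GONE; no temperedness of `π_v` is used either (purity
of `W` is a consequence, `isPure_of_finrank_range_pow_le`). [new]
(inputs in print: [cite: VarmaFMS2024, Thms. 1–2]; mechanism: [cite: TaylorYoshida2007,
Lemma 1.4 (4)]) -/
theorem localGlobalCompatibleAt_of_isPure_of_finrank_range_pow_le (𝓡 : ReciprocityData K)
    (ι : PadicAlgCl ℓ ≃+* ℂ) (π : AutomorphicRepData (AutomorphyDatum.gl n K hcpt))
    (ρ : FramedGaloisRep K (PadicAlgCl ℓ) n) (v : HeightOneSpectrum (𝓞 K))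
    (πv : SmoothIrrep (GL (Fin n) (v.adicCompletion K))) (hπv : π.HasLocalComponentAt v πv.ρ)
    (r : WeilDeligneRep (v.adicCompletion K) (PadicAlgCl ℓ) (Fin n → PadicAlgCl ℓ))
    (hr : ((ℓ : ℕ) : 𝓞 K) ∉ v.asIdeal → IsWeilDeligneOfLadic (ρ.toLocal v).toWeilGroupHom r)
    (hr' : ∀ hv : ((ℓ : ℕ) : 𝓞 K) ∈ v.asIdeal, (𝓡.pst ℓ v hv).IsWeilDeligneOf (ρ.toLocal v) r)
    (rℂ : WeilDeligneRep (v.adicCompletion K) ℂ (Fin n → ℂ))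
    (hι : r.IsTransportAlong (ι : PadicAlgCl ℓ →+* ℂ) rℂ)
    (rss : WeilDeligneRep (v.adicCompletion K) ℂ (Fin n → ℂ))
    (hss : rss.IsFrobSemisimplificationOf rℂ)
    (W : {W : WeilDeligneRep (v.adicCompletion K) ℂ (Fin n → ℂ) // W.IsFrobSemisimple})
    (hW : Quotient.mk (frobSemisimpleWDSetoid (v.adicCompletion K) n) W =
      (𝓡.llc v).recGL n (IrrClass.mk πv))
    (hWρ : W.1.ρ = rss.ρ)
    (hdom : ∀ i : ℕ, finrank ℂ ↥(LinearMap.range (rss.N ^ i)) ≤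
      finrank ℂ ↥(LinearMap.range (W.1.N ^ i)))
    {φ : WeilGroup (v.adicCompletion K)} (hφ : WeilGroup.deg φ = -1) {k : ℝ}
    (hpure : rss.IsPure φ k) :
    LocalGlobalCompatibleAt 𝓡 ι π ρ v :=
  ⟨πv, r, rℂ, hπv, hr, hr', hι,
    hW ▸ hasFrobSemisimpleClass_of_isPure_of_finrank_range_pow_le hss hφ hpure W hWρ hdom⟩

end Summit.Langlands.Langlands.Theorems

end
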